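import Literature.AlgebraicGeometry.Motives.AbelianVarietyLatticeTensorIsogeny
import Literature.AlgebraicGeometry.Motives.AbelianVarietyLatticeTensorSumsProducts
import HarnessLib

/-!
# Decomposing the lattice decomposes the twist: `M_ℚ ≅ (M₁ ⊕ M₂)_ℚ ⟹ Y ⊗ M ∼_G (Y ⊗ M₁) ⊞ (Y ⊗ M₂)` equivariantly up to isogeny
# (Mazur–Rubin–Silverberg Cor. 2.5), uniqueness of `Y ⊗_β M` up to equivariant isomorphism (Def. 1.1 / Cor. 1.9), and
# `(Y ⊗ M) ⊗ N ≅_G Y ⊗ (N ⊗ M)` (Prop. 2.6) as an equivariant isomorphism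

Sequel of `Motives/AbelianVarietyLatticeTensorIsogeny` (equivariant isogenies `P_Y` from intertwiners `P`, Lemma 2.4) and
`Motives/AbelianVarietyLatticeTensorSumsProducts` (the sum and flattened bicones).  Notation as there: `Y` an abelian variety over a
field `K`; `X = Y ⊗_β M` a bicone `b` over `(Y)_{i ∈ ι}` with `Σ π_i ι_i = 𝟙` and an action `ρ` with blocks `ι_j ρ(g) π_i = m(g)_{ij} • β(g)`.

* §0 **UNIQUENESS OF `Y ⊗_β M` UP TO EQUIVARIANT ISOMORPHISM**: two lattice tensors with the same `(m, β)` over the same index set — whatever bicones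
  realise them — are joined by mutually inverse `G`-equivariant morphisms (`exists_equivariant_iso_pair`; MRS Def. 1.1: "`I ⊗_𝒪 V`
  is independent of the choice", Cor. 1.9 with `f = id`; Lemma 2.4 of the prequel with `P = Q = 1`).
* §1 **MRS Cor. 2.5, equivariantly**: if `P : M → M₁ ⊕ M₂` is an integral intertwiner (`P m(g) = diag(m₁(g), m₂(g)) P`) with a
  quasi-inverse `Q` (`Q P = d · 1 = P Q`, `d ≠ 0` — i.e. `M_ℚ ≅ (M₁)_ℚ ⊕ (M₂)_ℚ` as `ℚ[G]`-modules), then for the product action on a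
  binary bicone `B` of `Y ⊗_β M₁` and `Y ⊗_β M₂` (injections equivariant) there are **`G`-EQUIVARIANT ISOGENIES
  `Y ⊗_β M ⇄ (Y ⊗_β M₁) ⊞ (Y ⊗_β M₂)` composing to `[d]`** (`exists_equivariant_isogeny_pair_biprod`: the sum bicone of the prequel
  carries the lattice tensor of `diag(m₁, m₂)`, to which Lemma 2.4 applies, and the identification `e` of the sum bicone with `B.pt`
  is equivariant); in particular `Y^ι ∼ Y^{ι₁} ⊞ Y^{ι₂}` (`isIsogenous_biprod_of_intertwines`) and, for `P = 1`, an equivariant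
  ISOMORPHISM between any realisation of `Y ⊗_β (M₁ ⊕ M₂)` and the biproduct (`exists_equivariant_iso_pair_biprod`); numerically, and
  without any biproduct, **`tr m = tr m₁ + tr m₂`** (`trace_eq_trace_add_trace_of_intertwines`), **`dim B_H(Y ⊗ M) = dim B_H(Y ⊗ M₁) +
  dim B_H(Y ⊗ M₂)`** and **`dim B_W(Y ⊗ M) = dim B_W(Y ⊗ M₁) + dim B_W(Y ⊗ M₂)`** over any field (untwisted tensors;
  `dim_image_norm_eq_add_of_intertwines`, `dim_isotypical_eq_add_of_intertwines`) — "`Res V ∼ ⊕_ρ I_ρ ⊗ V`" componentwise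
  (MRS Thm. 4.5 is this with `M = ℤ[G]`, `M_ρ = ℤ[G] ∩ e_ρ ℚ[G]`).
* §2 **MRS Prop. 2.6 as an equivariant isomorphism**: the iterated tensor `(Y ⊗_β M) ⊗_ρ N` (outer blocks `n(g)_{kl} • ρ(g)`) and ANY
  realisation `d'` of `Y ⊗_β (N ⊗ M)` (blocks `(n(g) ⊗ₖ m(g))_{pq} • β(g)`) are joined by mutually inverse `G`-equivariant morphisms
  (`exists_equivariant_iso_pair_kronecker`: flatten, then §0).

Everything is a theorem; no definition, instance or notation is introduced; the isogenies / isomorphisms are produced as existence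
statements with their defining properties (equivariance, `F F' = [d]`).

## References

* [MazurRubinSilverberg2007] B. Mazur, K. Rubin, A. Silverberg, *Twisting commutative algebraic groups*, J. Algebra 314 (2007)
  419–438: Def. 1.1, Cor. 1.9 (`I ≅ J` over `𝒪[G_F]` ⇒ `I ⊗ V ≅ J ⊗ V` over `F`), Lemma 2.4 (`s : I → J` an isogeny ⇒ `s_V` a
  `k`-isogeny), Cor. 2.5 ("`I ⊗_ℤ ℚ ≅ ⊕ J_i ⊗_ℤ ℚ` as `𝒪[G_k]`-modules ⇒ `I ⊗_𝒪 V` is `k`-isogenous to `⊕ (J_i ⊗_𝒪 V)`"; proof: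
  "`I` is isogenous to `⊕ J_i`, so by Lemma 2.4 …, `(⊕ J_i) ⊗ V ≅ ⊕ (J_i ⊗ V)`"), Prop. 2.6, Def. 4.3 and Thm. 4.5 (`Res V ∼ ⊕ I_ρ ⊗ V`).
  Held: `paper:doi-10-1016-j-jalgebra-2007-02-052`, PDF pp. 3, 5–7, 10 read 2026-08-28.
* [SerreLinearRepresentations1977] J.-P. Serre, *Linear Representations of Finite Groups*, GTM 42 (1977): §1.1 (similar
  representations), §1.3 (direct sums in matrix form, PDF p. 12), §1.5 (tensor products, PDF p. 13), §2.1 Prop. 2, §2.3, §2.6 Thm. 8.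
* [LangeRodriguez2022] H. Lange, R. E. Rodríguez, *Decomposition of Jacobians by Prym Varieties*, LNM 2310 (2022), §2.9.1 Prop. 2.9.3
  (PDF p. 46).
* [KaniRosen1989] E. Kani, M. Rosen, *Idempotent relations and factors of Jacobians*, Math. Ann. 284 (1989), §3 Thm. B.
* [MumfordAV1970] D. Mumford, *Abelian Varieties* (1970), §19 Thm. 3 (p. 176), Thm. 4 (p. 180).
-/

noncomputable section

open CategoryTheory CategoryTheory.Limits
open Literature.NumberTheory.DiophantineGeometry
open Literature.RepresentationTheory.FiniteGroups
open scoped Kronecker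

universe u

namespace Literature.AlgebraicGeometry.Motives

namespace AbelianVariety

namespace LatticeTensor

variable {K : Type u} [Field K]

/-! ## §0 `Y ⊗_β M` is unique up to equivariant isomorphism -/

section Unique

variable {Y : AbelianVariety K} {ι : Type} [Fintype ι] [DecidableEq ι] (b b' : Bicone (fun _ : ι ↦ Y))
  {G : Type} [Group G] (m : G →* Matrix ι ι ℤ) (β : G →* End Y) (ρ : G →* End b.pt) (ρ' : G →* End b'.pt)

/-- **`Y ⊗_β M` is unique up to equivariant isomorphism**: two lattice tensors with the SAME matrix representation `m` and twist `β`
over the same index set (two bicones `b`, `b'` on `(Y)_{i ∈ ι}`, actions `ρ`, `ρ'` with `ι_j ρ(g) π_i = m(g)_{ij} • β(g) = ι_j ρ'(g) π_i`)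
are joined by mutually inverse `G`-equivariant morphisms `F = Σ_i π_i ≫ ι'_i`, `F' = Σ_i π'_i ≫ ι_i` — "`I ⊗_𝒪 V` is independent of the
choices" / Cor. 1.9 with `f = id` (the prequel's Lemma 2.4 with `P = Q = 1`, `d = 1`). [cite: MazurRubinSilverberg2007, Def. 1.1 and Cor. 1.9]
[cite: SerreLinearRepresentations1977, §1.1 (isomorphic representations, `T R_s = R'_s T`)] -/
theorem exists_equivariant_iso_pair (hb : ∑ j, b.π j ≫ b.ι j = 𝟙 b.pt) (hb' : ∑ j, b'.π j ≫ b'.ι j = 𝟙 b'.pt)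
    (hρ : ∀ (g : G) (i j : ι), b.ι j ≫ End.asHom (ρ g) ≫ b.π i = m g i j • End.asHom (β g))
    (hρ' : ∀ (g : G) (i j : ι), b'.ι j ≫ End.asHom (ρ' g) ≫ b'.π i = m g i j • End.asHom (β g)) :
    ∃ (F : b.pt ⟶ b'.pt) (F' : b'.pt ⟶ b.pt), F ≫ F' = 𝟙 b.pt ∧ F' ≫ F = 𝟙 b'.pt ∧
      (∀ g : G, End.asHom (ρ g) ≫ F = F ≫ End.asHom (ρ' g)) ∧ (∀ g : G, End.asHom (ρ' g) ≫ F' = F' ≫ End.asHom (ρ g)) := by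
  obtain ⟨F, F', -, -, hF, hF', hFF', hF'F⟩ := exists_equivariant_isogeny_pair b b' m m β ρ ρ' hb hb' hρ hρ'
    (P := 1) (Q := 1) (d := 1) (fun g ↦ by rw [one_mul, mul_one]) (by simp) (by simp) one_ne_zero
  exact ⟨F, F', by simpa using hFF', by simpa using hF'F, hF, hF'⟩

end Unique

/-! ## §1 MRS Cor. 2.5: `M_ℚ ≅ (M₁ ⊕ M₂)_ℚ ⟹ Y ⊗_β M ⇄ (Y ⊗_β M₁) ⊞ (Y ⊗_β M₂)` by equivariant isogenies composing to `[d]` -/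

section Decomposition

variable {Y : AbelianVariety K} {ι ι₁ ι₂ : Type} [Fintype ι] [Fintype ι₁] [Fintype ι₂]
  [DecidableEq ι] [DecidableEq ι₁] [DecidableEq ι₂]
  (b : Bicone (fun _ : ι ↦ Y)) (b₁ : Bicone (fun _ : ι₁ ↦ Y)) (b₂ : Bicone (fun _ : ι₂ ↦ Y)) (B : BinaryBicone b₁.pt b₂.pt)
  {G : Type} [Group G] (m : G →* Matrix ι ι ℤ) (m₁ : G →* Matrix ι₁ ι₁ ℤ) (m₂ : G →* Matrix ι₂ ι₂ ℤ) (β : G →* End Y)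
  (ρ : G →* End b.pt) (ρ₁ : G →* End b₁.pt) (ρ₂ : G →* End b₂.pt) (ρB : G →* End B.pt)

/-- **MRS Cor. 2.5 for `Y ⊗_β M`, equivariantly.**  Let `P : ℤ^ι → ℤ^{ι₁ ⊕ ι₂}` intertwine `m` with `diag(m₁, m₂)` and have a
quasi-inverse `Q` (`Q P = d · 1`, `P Q = d · 1`, `d ≠ 0`: the lattices `M` and `M₁ ⊕ M₂` are isomorphic over `ℚ`), and let `ρ_B` be
the product action (injections equivariant) on a binary bicone `B` of the lattice tensors `Y ⊗_β M₁`, `Y ⊗_β M₂` with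
`fst inl + snd inr = 𝟙`.  Then there are **`G`-equivariant isogenies `F : Y ⊗_β M → B.pt`, `F' : B.pt → Y ⊗_β M` with
`F F' = [d]`, `F' F = [d]`** — "`I ⊗_ℤ ℚ ≅ ⊕ (J_i ⊗_ℤ ℚ)` as `𝒪[G]`-modules ⇒ `I ⊗ V` is isogenous to `⊕ (J_i ⊗ V)`".  Proof: the sum
bicone on `B.pt` (prequel) is the lattice tensor of `diag(m₁, m₂)` twisted by `β`; apply Lemma 2.4 (`exists_equivariant_isogeny_pair`)
to `P`, `Q` and compose with the equivariant identification `e`. [cite: MazurRubinSilverberg2007, Cor. 2.5 (and proof), Lemma 2.4, Thm. 4.5]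
[cite: SerreLinearRepresentations1977, §1.3 (PDF p. 12)] -/
theorem exists_equivariant_isogeny_pair_biprod (hb : ∑ j, b.π j ≫ b.ι j = 𝟙 b.pt) (hb₁ : ∑ j, b₁.π j ≫ b₁.ι j = 𝟙 b₁.pt)
    (hb₂ : ∑ l, b₂.π l ≫ b₂.ι l = 𝟙 b₂.pt) (hB : B.fst ≫ B.inl + B.snd ≫ B.inr = 𝟙 B.pt)
    (hρ : ∀ (g : G) (i j : ι), b.ι j ≫ End.asHom (ρ g) ≫ b.π i = m g i j • End.asHom (β g))
    (hρ₁ : ∀ (g : G) (i j : ι₁), b₁.ι j ≫ End.asHom (ρ₁ g) ≫ b₁.π i = m₁ g i j • End.asHom (β g))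
    (hρ₂ : ∀ (g : G) (k l : ι₂), b₂.ι l ≫ End.asHom (ρ₂ g) ≫ b₂.π k = m₂ g k l • End.asHom (β g))
    (hinl : ∀ g, B.inl ≫ End.asHom (ρB g) = End.asHom (ρ₁ g) ≫ B.inl)
    (hinr : ∀ g, B.inr ≫ End.asHom (ρB g) = End.asHom (ρ₂ g) ≫ B.inr)
    {P : Matrix (ι₁ ⊕ ι₂) ι ℤ} {Q : Matrix ι (ι₁ ⊕ ι₂) ℤ} {d : ℤ}
    (hP : ∀ g : G, P * m g = Matrix.fromBlocks (m₁ g) 0 0 (m₂ g) * P)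
    (hQP : Q * P = d • (1 : Matrix ι ι ℤ)) (hPQ : P * Q = d • (1 : Matrix (ι₁ ⊕ ι₂) (ι₁ ⊕ ι₂) ℤ)) (hd : d ≠ 0) :
    ∃ (F : b.pt ⟶ B.pt) (F' : B.pt ⟶ b.pt), IsIsogeny F ∧ IsIsogeny F' ∧
      (∀ g : G, End.asHom (ρ g) ≫ F = F ≫ End.asHom (ρB g)) ∧ (∀ g : G, End.asHom (ρB g) ≫ F' = F' ≫ End.asHom (ρ g)) ∧
      F ≫ F' = d • 𝟙 b.pt ∧ F' ≫ F = d • 𝟙 B.pt := by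
  obtain ⟨dd, e, hπ₁, hπ₂, hι₁, hι₂⟩ := exists_sumBicone b₁ b₂ B
  have hdd := sumBicone_total b₁ b₂ B hb₁ hb₂ hB hπ₁ hπ₂ hι₁ hι₂
  obtain ⟨ρ'', hρ''⟩ := exists_conjAction e ρB
  obtain ⟨mn, hmn⟩ := exists_fromBlocksRep m₁ m₂
  have hblk : ∀ (g : G) (s t : ι₁ ⊕ ι₂), dd.ι t ≫ End.asHom (ρ'' g) ≫ dd.π s = mn g s t • End.asHom (β g) := by
    intro g s t
    rw [hmn]
    exact sumBicone_blocks_action b₁ b₂ B m₁ m₂ β ρ₁ ρ₂ ρB hρ₁ hρ₂ hinl hinr hπ₁ hπ₂ hι₁ hι₂ hρ'' g s t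
  have hP' : ∀ g : G, P * m g = mn g * P := fun g ↦ by rw [hmn]; exact hP g
  obtain ⟨F, F', hF, hF', hFc, hF'c, hFF', hF'F⟩ :=
    exists_equivariant_isogeny_pair b dd m mn β ρ ρ'' hb hdd hρ hblk hP' hQP hPQ hd
  have hinv : ∀ g, End.asHom (ρB g) ≫ e.inv = e.inv ≫ End.asHom (ρ'' g) := fun g ↦ by
    rw [hρ'', e.inv_hom_id_assoc]
  refine ⟨F ≫ e.hom, e.inv ≫ F', isIsogeny_comp hF (isIsogeny_hom_of_iso e), isIsogeny_comp (isIsogeny_hom_of_iso e.symm) hF',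
    fun g ↦ ?_, fun g ↦ ?_, ?_, ?_⟩
  · rw [reassoc_of% (hFc g), conjAction_comm hρ'' g, Category.assoc]
  · rw [reassoc_of% (hinv g), hF'c g, Category.assoc]
  · rw [Category.assoc, e.hom_inv_id_assoc, hFF']
  · rw [Category.assoc, reassoc_of% hF'F, Preadditive.zsmul_comp, Category.id_comp, Preadditive.comp_zsmul, e.inv_hom_id]

/-- **`Y^ι ∼ Y^{ι₁} ⊞ Y^{ι₂}` whenever integral matrices `P ∈ M_{(ι₁ ⊕ ι₂) × ι}(ℤ)`, `Q` with `Q P = d · 1 = P Q`, `d ≠ 0` exist**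
(e.g. `|ι| = |ι₁| + |ι₂|`): the action-free shadow of Cor. 2.5. [cite: MazurRubinSilverberg2007, Lemma 2.4 and Cor. 2.5] -/
theorem isIsogenous_biprod_of_intertwines (hb : ∑ j, b.π j ≫ b.ι j = 𝟙 b.pt) (hb₁ : ∑ j, b₁.π j ≫ b₁.ι j = 𝟙 b₁.pt)
    (hb₂ : ∑ l, b₂.π l ≫ b₂.ι l = 𝟙 b₂.pt) (hB : B.fst ≫ B.inl + B.snd ≫ B.inr = 𝟙 B.pt)
    {P : Matrix (ι₁ ⊕ ι₂) ι ℤ} {Q : Matrix ι (ι₁ ⊕ ι₂) ℤ} {d : ℤ}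
    (hQP : Q * P = d • (1 : Matrix ι ι ℤ)) (hPQ : P * Q = d • (1 : Matrix (ι₁ ⊕ ι₂) (ι₁ ⊕ ι₂) ℤ)) (hd : d ≠ 0) :
    IsIsogenous b.pt B.pt := by
  classical
  obtain ⟨dd, e, hπ₁, hπ₂, hι₁, hι₂⟩ := exists_sumBicone b₁ b₂ B
  have hdd := sumBicone_total b₁ b₂ B hb₁ hb₂ hB hπ₁ hπ₂ hι₁ hι₂
  obtain ⟨F, hF⟩ := isIsogenous_of_intertwines b dd hb hdd hQP hPQ hd
  exact ⟨F ≫ e.hom, isIsogeny_comp hF (isIsogeny_hom_of_iso e)⟩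

/-- **Any realisation of `Y ⊗_β (M₁ ⊕ M₂)` is equivariantly ISOMORPHIC to `(Y ⊗_β M₁) ⊞ (Y ⊗_β M₂)`** (the case `P = Q = 1` of Cor. 2.5:
a bicone `b` over `ι₁ ⊕ ι₂` with action of blocks `diag(m₁(g), m₂(g))_{st} • β(g)` against the product action on a total binary
bicone of the two summand tensors). [cite: MazurRubinSilverberg2007, Cor. 2.5 (proof: `(⊕ J_i) ⊗ V ≅ ⊕ (J_i ⊗ V)`) and Thm. 1.8]
[cite: SerreLinearRepresentations1977, §1.3 (PDF p. 12)] -/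
theorem exists_equivariant_iso_pair_biprod (b' : Bicone (fun _ : ι₁ ⊕ ι₂ ↦ Y)) (σ : G →* End b'.pt)
    (hb' : ∑ s, b'.π s ≫ b'.ι s = 𝟙 b'.pt) (hb₁ : ∑ j, b₁.π j ≫ b₁.ι j = 𝟙 b₁.pt)
    (hb₂ : ∑ l, b₂.π l ≫ b₂.ι l = 𝟙 b₂.pt) (hB : B.fst ≫ B.inl + B.snd ≫ B.inr = 𝟙 B.pt)
    (hσ : ∀ (g : G) (s t : ι₁ ⊕ ι₂), b'.ι t ≫ End.asHom (σ g) ≫ b'.π s = Matrix.fromBlocks (m₁ g) 0 0 (m₂ g) s t • End.asHom (β g))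
    (hρ₁ : ∀ (g : G) (i j : ι₁), b₁.ι j ≫ End.asHom (ρ₁ g) ≫ b₁.π i = m₁ g i j • End.asHom (β g))
    (hρ₂ : ∀ (g : G) (k l : ι₂), b₂.ι l ≫ End.asHom (ρ₂ g) ≫ b₂.π k = m₂ g k l • End.asHom (β g))
    (hinl : ∀ g, B.inl ≫ End.asHom (ρB g) = End.asHom (ρ₁ g) ≫ B.inl)
    (hinr : ∀ g, B.inr ≫ End.asHom (ρB g) = End.asHom (ρ₂ g) ≫ B.inr) :
    ∃ (F : b'.pt ⟶ B.pt) (F' : B.pt ⟶ b'.pt), F ≫ F' = 𝟙 b'.pt ∧ F' ≫ F = 𝟙 B.pt ∧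
      (∀ g : G, End.asHom (σ g) ≫ F = F ≫ End.asHom (ρB g)) ∧ (∀ g : G, End.asHom (ρB g) ≫ F' = F' ≫ End.asHom (σ g)) := by
  obtain ⟨mn, hmn⟩ := exists_fromBlocksRep m₁ m₂
  have hσ' : ∀ (g : G) (s t : ι₁ ⊕ ι₂), b'.ι t ≫ End.asHom (σ g) ≫ b'.π s = mn g s t • End.asHom (β g) := fun g s t ↦ by
    rw [hmn]; exact hσ g s t
  obtain ⟨F, F', -, -, hFc, hF'c, hFF', hF'F⟩ := exists_equivariant_isogeny_pair_biprod b' b₁ b₂ B mn m₁ m₂ β σ ρ₁ ρ₂ ρB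
    hb' hb₁ hb₂ hB hσ' hρ₁ hρ₂ hinl hinr (P := 1) (Q := 1) (d := 1) (fun g ↦ by rw [one_mul, mul_one, hmn]) (by simp)
    (by simp) one_ne_zero
  exact ⟨F, F', by simpa using hFF', by simpa using hF'F, hFc, hF'c⟩

/-- **`tr m(g) = tr m₁(g) + tr m₂(g)` when `M_ℚ ≅ (M₁ ⊕ M₂)_ℚ`** (an integral intertwiner `P m = diag(m₁, m₂) P` with a quasi-inverse):
similar matrices have equal traces and `tr diag(A, D) = tr A + tr D`. [cite: SerreLinearRepresentations1977, §2.1 Prop. 2 (i) (PDF p. 15)] -/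
theorem trace_eq_trace_add_trace_of_intertwines {P : Matrix (ι₁ ⊕ ι₂) ι ℤ} {Q : Matrix ι (ι₁ ⊕ ι₂) ℤ} {d : ℤ}
    (hP : ∀ g : G, P * m g = Matrix.fromBlocks (m₁ g) 0 0 (m₂ g) * P)
    (hQP : Q * P = d • (1 : Matrix ι ι ℤ)) (hPQ : P * Q = d • (1 : Matrix (ι₁ ⊕ ι₂) (ι₁ ⊕ ι₂) ℤ)) (hd : d ≠ 0) (g : G) :
    (m g).trace = (m₁ g).trace + (m₂ g).trace := by
  classical
  obtain ⟨mn, hmn⟩ := exists_fromBlocksRep m₁ m₂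
  have hP' : ∀ g : G, P * m g = mn g * P := fun g ↦ by rw [hmn]; exact hP g
  rw [trace_eq_trace_of_intertwines m mn hP' hQP hPQ hd g, hmn]
  simp [Matrix.trace, Fintype.sum_sum_type]

/-- **`dim B_H(Y ⊗ M) = dim B_H(Y ⊗ M₁) + dim B_H(Y ⊗ M₂)` over ANY field when `M_ℚ ≅ (M₁ ⊕ M₂)_ℚ`** (untwisted tensors, `H` a finite
subgroup, `B_H = Im Σ_h ρ(h)`; no biproduct needed): `|H| dim B_H(Y ⊗ M) = (Σ_h tr m(h)) dim Y` (the tree's `card_mul_dim_image_norm_eq`)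
and `tr m = tr m₁ + tr m₂`. [cite: MazurRubinSilverberg2007, Cor. 2.5 and Thm. 4.5] [cite: LangeRodriguez2022, §2.9.1 Prop. 2.9.3 (PDF p. 46)]
[cite: KaniRosen1989, §3 Thm. B] -/
theorem dim_image_norm_eq_add_of_intertwines {H : Subgroup G} [Fintype H] (hb : ∑ j, b.π j ≫ b.ι j = 𝟙 b.pt)
    (hb₁ : ∑ j, b₁.π j ≫ b₁.ι j = 𝟙 b₁.pt) (hb₂ : ∑ l, b₂.π l ≫ b₂.ι l = 𝟙 b₂.pt)
    (hρ : ∀ (g : G) (i j : ι), b.ι j ≫ End.asHom (ρ g) ≫ b.π i = m g i j • 𝟙 Y)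
    (hρ₁ : ∀ (g : G) (i j : ι₁), b₁.ι j ≫ End.asHom (ρ₁ g) ≫ b₁.π i = m₁ g i j • 𝟙 Y)
    (hρ₂ : ∀ (g : G) (k l : ι₂), b₂.ι l ≫ End.asHom (ρ₂ g) ≫ b₂.π k = m₂ g k l • 𝟙 Y)
    {P : Matrix (ι₁ ⊕ ι₂) ι ℤ} {Q : Matrix ι (ι₁ ⊕ ι₂) ℤ} {d : ℤ}
    (hP : ∀ g : G, P * m g = Matrix.fromBlocks (m₁ g) 0 0 (m₂ g) * P)
    (hQP : Q * P = d • (1 : Matrix ι ι ℤ)) (hPQ : P * Q = d • (1 : Matrix (ι₁ ⊕ ι₂) (ι₁ ⊕ ι₂) ℤ)) (hd : d ≠ 0)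
    {N : b.pt ⟶ b.pt} (hN : End.of N = ∑ h : H, ρ h) {N₁ : b₁.pt ⟶ b₁.pt} (hN₁ : End.of N₁ = ∑ h : H, ρ₁ h)
    {N₂ : b₂.pt ⟶ b₂.pt} (hN₂ : End.of N₂ = ∑ h : H, ρ₂ h) :
    (image N).dim = (image N₁).dim + (image N₂).dim := by
  classical
  have h := card_mul_dim_image_norm_eq b m ρ hb hρ hN
  have h₁ := card_mul_dim_image_norm_eq b₁ m₁ ρ₁ hb₁ hρ₁ hN₁
  have h₂ := card_mul_dim_image_norm_eq b₂ m₂ ρ₂ hb₂ hρ₂ hN₂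
  simp_rw [trace_eq_trace_add_trace_of_intertwines m m₁ m₂ hP hQP hPQ hd, Finset.sum_add_distrib, add_mul] at h
  rw [← h₁, ← h₂, ← Nat.cast_add, Nat.cast_inj] at h
  have h' : Fintype.card H * (image N).dim = Fintype.card H * ((image N₁).dim + (image N₂).dim) := by rw [mul_add, ← h]
  exact Nat.eq_of_mul_eq_mul_left (Fintype.card_pos (α := H)) h'

variable [Fintype G] {a : ratCharIdempotents G → G → ℤ}
  (ha : ∀ e : ratCharIdempotents G,
    (Fintype.card G : ℚ) • (e : MonoidAlgebra ℚ G) = ∑ g, (a e g : ℚ) • MonoidAlgebra.of ℚ G g)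
  {u : ratCharIdempotents G → (b.pt ⟶ b.pt)} (hu : ∀ e, End.of (u e) = ∑ g, a e g • ρ g)
  {u₁ : ratCharIdempotents G → (b₁.pt ⟶ b₁.pt)} (hu₁ : ∀ e, End.of (u₁ e) = ∑ g, a e g • ρ₁ g)
  {u₂ : ratCharIdempotents G → (b₂.pt ⟶ b₂.pt)} (hu₂ : ∀ e, End.of (u₂ e) = ∑ g, a e g • ρ₂ g)

include ha hu hu₁ hu₂

/-- **`dim B_W(Y ⊗ M) = dim B_W(Y ⊗ M₁) + dim B_W(Y ⊗ M₂)` over ANY field for every isotypical component when `M_ℚ ≅ (M₁ ⊕ M₂)_ℚ`**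
(untwisted tensors; `B_W = Im u_W`, `u_W = Σ_g c_W(g) ρ(g)`): "`Res V ∼ ⊕_ρ I_ρ ⊗ V`" read componentwise.
[cite: MazurRubinSilverberg2007, Cor. 2.5, Def. 4.3 and Thm. 4.5] [cite: LangeRodriguez2022, §2.9.1 Prop. 2.9.3 (PDF p. 46)]
[cite: SerreLinearRepresentations1977, §2.6 Thm. 8] -/
theorem dim_isotypical_eq_add_of_intertwines (hb : ∑ j, b.π j ≫ b.ι j = 𝟙 b.pt)
    (hb₁ : ∑ j, b₁.π j ≫ b₁.ι j = 𝟙 b₁.pt) (hb₂ : ∑ l, b₂.π l ≫ b₂.ι l = 𝟙 b₂.pt)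
    (hρ : ∀ (g : G) (i j : ι), b.ι j ≫ End.asHom (ρ g) ≫ b.π i = m g i j • 𝟙 Y)
    (hρ₁ : ∀ (g : G) (i j : ι₁), b₁.ι j ≫ End.asHom (ρ₁ g) ≫ b₁.π i = m₁ g i j • 𝟙 Y)
    (hρ₂ : ∀ (g : G) (k l : ι₂), b₂.ι l ≫ End.asHom (ρ₂ g) ≫ b₂.π k = m₂ g k l • 𝟙 Y)
    {P : Matrix (ι₁ ⊕ ι₂) ι ℤ} {Q : Matrix ι (ι₁ ⊕ ι₂) ℤ} {d : ℤ}
    (hP : ∀ g : G, P * m g = Matrix.fromBlocks (m₁ g) 0 0 (m₂ g) * P)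
    (hQP : Q * P = d • (1 : Matrix ι ι ℤ)) (hPQ : P * Q = d • (1 : Matrix (ι₁ ⊕ ι₂) (ι₁ ⊕ ι₂) ℤ)) (hd : d ≠ 0)
    (e : ratCharIdempotents G) :
    (image (u e)).dim = (image (u₁ e)).dim + (image (u₂ e)).dim := by
  classical
  have h := card_mul_dim_isotypical_eq b m ρ ha hu hb hρ e
  have h₁ := card_mul_dim_isotypical_eq b₁ m₁ ρ₁ ha hu₁ hb₁ hρ₁ e
  have h₂ := card_mul_dim_isotypical_eq b₂ m₂ ρ₂ ha hu₂ hb₂ hρ₂ e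
  simp_rw [trace_eq_trace_add_trace_of_intertwines m m₁ m₂ hP hQP hPQ hd, mul_add, Finset.sum_add_distrib, add_mul] at h
  rw [← h₁, ← h₂, ← Nat.cast_add, Nat.cast_inj] at h
  have h' : Fintype.card G * (image (u e)).dim = Fintype.card G * ((image (u₁ e)).dim + (image (u₂ e)).dim) := by
    rw [mul_add, ← h]
  exact Nat.eq_of_mul_eq_mul_left (Fintype.card_pos (α := G)) h'

end Decomposition

/-! ## §2 MRS Prop. 2.6 as an equivariant isomorphism: `(Y ⊗_β M) ⊗_ρ N ≅_G Y ⊗_β (N ⊗ M)` -/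

section Kronecker

variable {Y : AbelianVariety K} {ι κ : Type} [Fintype ι] [Fintype κ] [DecidableEq ι] [DecidableEq κ]
  (b : Bicone (fun _ : ι ↦ Y)) (c : Bicone (fun _ : κ ↦ b.pt)) (d' : Bicone (fun _ : κ × ι ↦ Y)) {G : Type} [Group G]
  (m : G →* Matrix ι ι ℤ) (n : G →* Matrix κ κ ℤ) (nm : G →* Matrix (κ × ι) (κ × ι) ℤ) (β : G →* End Y)
  (ρ : G →* End b.pt) (ρ' : G →* End c.pt) (σ : G →* End d'.pt)

/-- **`(Y ⊗_β M) ⊗_ρ N ≅ Y ⊗_β (N ⊗ M)`, `G`-equivariantly**: the iterated tensor (`c` over `(Y ⊗ M)_{k ∈ κ}`, outer blocks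
`n(g)_{kl} • ρ(g)`, inner blocks `m(g)_{ij} • β(g)`) and ANY realisation `d'` of the lattice tensor of the Kronecker representation
`nm(g) = n(g) ⊗ₖ m(g)` twisted by `β` are joined by mutually inverse `G`-equivariant morphisms — "a natural isomorphism
`(I ⊗_𝒪 J) ⊗_𝒪 V ≅ I ⊗_𝒪 (J ⊗_𝒪 V)`".  Proof: flatten `c` (prequel), then uniqueness (§0).
[cite: MazurRubinSilverberg2007, Prop. 2.6] [cite: SerreLinearRepresentations1977, §1.5 (PDF p. 13)] -/
theorem exists_equivariant_iso_pair_kronecker (hb : ∑ j, b.π j ≫ b.ι j = 𝟙 b.pt) (hc : ∑ k, c.π k ≫ c.ι k = 𝟙 c.pt)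
    (hd' : ∑ p, d'.π p ≫ d'.ι p = 𝟙 d'.pt)
    (hρ : ∀ (g : G) (i j : ι), b.ι j ≫ End.asHom (ρ g) ≫ b.π i = m g i j • End.asHom (β g))
    (hρ' : ∀ (g : G) (k l : κ), c.ι l ≫ End.asHom (ρ' g) ≫ c.π k = n g k l • End.asHom (ρ g))
    (hnm : ∀ g, nm g = n g ⊗ₖ m g)
    (hσ : ∀ (g : G) (p q : κ × ι), d'.ι q ≫ End.asHom (σ g) ≫ d'.π p = nm g p q • End.asHom (β g)) :
    ∃ (F : c.pt ⟶ d'.pt) (F' : d'.pt ⟶ c.pt), F ≫ F' = 𝟙 c.pt ∧ F' ≫ F = 𝟙 d'.pt ∧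
      (∀ g : G, End.asHom (ρ' g) ≫ F = F ≫ End.asHom (σ g)) ∧ (∀ g : G, End.asHom (σ g) ≫ F' = F' ≫ End.asHom (ρ' g)) := by
  obtain ⟨dd, e, hπ, hι⟩ := exists_prodBicone b c
  have hdd := prodBicone_total b c hb hc hπ hι
  obtain ⟨ρ'', hρ''⟩ := exists_conjAction e ρ'
  have hblk : ∀ (g : G) (p q : κ × ι), dd.ι q ≫ End.asHom (ρ'' g) ≫ dd.π p = nm g p q • End.asHom (β g) :=
    prodBicone_blocks_action_of_eq_kronecker b c m n β ρ ρ' hρ hρ' hπ hι hρ'' hnm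
  obtain ⟨F, F', hFF', hF'F, hFc, hF'c⟩ := exists_equivariant_iso_pair dd d' nm β ρ'' σ hdd hd' hblk hσ
  have hinv : ∀ g, End.asHom (ρ' g) ≫ e.inv = e.inv ≫ End.asHom (ρ'' g) := fun g ↦ by
    rw [hρ'', e.inv_hom_id_assoc]
  refine ⟨e.inv ≫ F, F' ≫ e.hom, ?_, ?_, fun g ↦ ?_, fun g ↦ ?_⟩
  · rw [Category.assoc, reassoc_of% hFF', e.inv_hom_id]
  · rw [Category.assoc, e.hom_inv_id_assoc, hF'F]
  · rw [reassoc_of% (hinv g), hFc g, Category.assoc]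
  · rw [reassoc_of% (hF'c g), conjAction_comm hρ'' g, Category.assoc]

end Kronecker

end LatticeTensor

end AbelianVariety

end Literature.AlgebraicGeometry.Motives
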